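import Summits.ResolutionOfSingularities.ResolutionOfSingularities.Theorems.PurelyInseparableDim4ResConeTwoSlotRelabel
import Summits.ResolutionOfSingularities.ResolutionOfSingularities.Theorems.PurelyInseparableDim4ResConeRotationFrameRel
import Summits.ResolutionOfSingularities.ResolutionOfSingularities.Theorems.PurelyInseparableDim4ResConeRotationTransfer
import Summits.ResolutionOfSingularities.ResolutionOfSingularities.Theorems.PurelyInseparableDim4ResConeTwoSlotTail
import Summits.ResolutionOfSingularities.ResolutionOfSingularities.Theorems.PurelyInseparableDim4JetColength
import HarnessLib
import HarnessLib.Audit.Tags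

/-!
# Purely inseparable four-folds — K24a-R1′: the ONE-STEP READINGS OF A ROTATION STEP of the two-slot tail, read
# in the canonical frames of the real parent and the real child (cell `res-dim4-pi`, K2(p) lane, slice B brick K24a,
# part R1c, file 4)

[OURS · counted 0 · cell `res-dim4-pi` · K2(p) lane (holder res-dim4-p-12; R1′(β) route agreed 2026-08-29 04:06Z);
seat res-dim4-p-1 g4 over its files 1–3 (`slot_step_relabel_*`, `rotation_frame_rel`, `transfer_*`), β4-S
`slot_step_readings`, SN1 `rotation_partner_readings`, β1 `exists_canonical_frame_state`, β3
`frame_reading_eq_zero_of_born`, and res-dim4-p-7 g4's graded transfer.]  Nothing here proves K2(p)/K2(5),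
`NoIsolatedTrap p p` or resolution of singularities in dimension ≥ 4 / characteristic `p`.  AI kernel work, weaker
than expert review.

SETTING.  A power-cone stretch (`ord₀ ≡ 6`, frame data `ℓ, a0, λ`) of a witnessed isolated above-floor `Step0 5`
chain; at stage `k ≥ k₀` a ROTATION step: boundary `r_k = e_a + e_o + e_ν`, chart the free letter `j k = f`,
translation `b k = τ′·e_a` (the slot `a` is lost: `r_{k+1} = e_f + e_o + e_ν`, new free letter `a`), T-sector
`ℓ_k f ≠ 0`, `F_k` clean, slot letters `a, o` stretch-born before `k`; canonical frames `φ` of `c k` at `f`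
(`coeff_{x_a} φ = −ℓ_k a/ℓ_k f`) and `ψ` of `c (k+1)` at `a`, straight and Tschirnhaus to order `7`.  Readings
`R m := coeff_{r_k + m} (clean (τ_φ F_k))`, `R′ n := coeff_{r_{k+1} + n} (clean (τ_ψ F_{k+1}))`.

* **`rotation_step_readings_chain`** — via the SWAP PARTNER `B = step 5 univ a (τ·e_f) (c k)`, `τ τ′ = 1` (a slot
  step of `c k`: `slot_step_readings` gives the parent legality and B's flag/relabelings in B's canonical frame),
  and the framed swap relation `S̃_B ← S̃_{c(k+1)}` (`rotation_frame_rel`, `s = 3` by `three_le_degree_of_framed_rel`,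
  readings moved by `transfer_deg_four/_two_three/_two_four`, shadows = structural zeros + born ledger at `k+1` +
  the live readings kept as disjuncts): LEGALITY `R(2a+2o) = R(3a+o) = R(2a+o+ν) = R(4a+o) = R(f+2a+o) = 0`;
  `R(2a+3o) ≠ 0 → R′(2f+3o) ∨ R′(f+3o) ∨ R′(2f+2o)`; `R(a+3o) ≠ 0 → R′(f+3o) ≠ 0`; `R(3a+2o) ≠ 0 → R′(2f+2o) ≠ 0`;
  `R(4a+2o) ≠ 0 → R′(2o+3f) ∨ R′(o+3f) ∨ R′(2o+2f)`; `R(f+a+2o) ≠ 0 → R′(a+f+2o) ≠ 0`; and the 8-term FLAG at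
  `k + 1` — exactly the instances `hlegL/hlegM`, `hfix`, `hfix'`, `hmuA`, `hmuB`, `hmuT`, `hflag` of the rotating
  two-slot game (`no_twoSlot_tail_of_readings_rotating`) at a rotation step.

[cite: CossartJannsenSaito2020, Thm. 3.14] [cite: Hauser2010, §6 (failure of maximal contact; coordinate changes)]
bears_on: LADDER-RESOLUTION:D157-DOOR2 (res-dim4-pi · K2(p) · slice B · K24a-R1c).  Supports
stmt-ResolutionOfSingularities-16155 (helper).
-/

set_option linter.dupNamespace false -- mandated namespace of this single-conjunct summit

noncomputable section

namespace Summit.ResolutionOfSingularities.ResolutionOfSingularities.Theorems.PIDim4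

namespace ResCone

open MvPolynomial Finset FrameChange
open Literature.AlgebraicGeometry.Resolution
open Literature.AlgebraicGeometry.Resolution.CentreBlowup
open Literature.AlgebraicGeometry.Resolution.Hauser2010
open Literature.AlgebraicGeometry.Resolution.HauserPerlega2019

variable {K : Type} [Field K]

section Rotation

variable [CharP K 5] [DecidableEq K]

/-- **THE ONE-STEP READINGS OF A ROTATION STEP** (K24a-R1c; statement and proof route in the module docstring).
[OURS] [cite: CossartJannsenSaito2020, Thm. 3.14] -/
theorem rotation_step_readings_chain {c : ℕ → State K} {j : ℕ → Fin 4} {b : ℕ → Fin 4 → K}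
    (hc : ∀ k, IsIsolated 5 (c k).F ∧ Step0 5 (c k) (c (k + 1))) (hw : FreeTail.IsWitnessedChain 5 c j b)
    (hr0 : ∀ e ∈ (c 0).F.support, (c 0).r ≤ e) (hfloor : ∀ k, ordZero (c k).F ≠ (5 : ℕ)) {k₀ : ℕ}
    (hshade : ∀ k, k₀ ≤ k → (c k).shade = ((3 : ℕ) : ℕ∞))
    (hord : ∀ k, k₀ ≤ k → ordZero (c k).F = ((6 : ℕ) : ℕ∞)) {ℓ : ℕ → Fin 4 → K} {a0 lam : ℕ → K}
    (hform : ∀ k, k₀ ≤ k → resForm (c k) = C (a0 k) * (∑ i, C (ℓ k i) * X i) ^ 3)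
    (hdir : ∀ k, k₀ ≤ k → ℓ k (j k) + dotProduct (ℓ k) (b k) = 0) (hlam : ∀ k, k₀ ≤ k → lam k ≠ 0)
    (hprop : ∀ k, k₀ ≤ k → ∀ i, i ≠ j k → ℓ (k + 1) i = lam k * ℓ k i)
    (hcarry : ∀ k, k₀ ≤ k → ∃ i, i ≠ j k ∧ ℓ k i ≠ 0) {k : ℕ} (hk : k₀ ≤ k) {a o ν f : Fin 4} (hao : a ≠ o)
    (haν : a ≠ ν) (haf : a ≠ f) (hoν : o ≠ ν) (hof : o ≠ f) (hνf : ν ≠ f)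
    (hrk : (c k).r = Finsupp.single a 1 + Finsupp.single o 1 + Finsupp.single ν 1)
    (hrk' : (c (k + 1)).r = Finsupp.single f 1 + Finsupp.single o 1 + Finsupp.single ν 1) (hjk : j k = f)
    (hb : b k = Pi.single a (b k a)) (hℓf : ℓ k f ≠ 0) (hclean : deletePthPowers 5 (c k).F = (c k).F)
    (hborna : ∃ t, k₀ ≤ t ∧ t < k ∧ j t = a ∧ ∀ m, t < m → m < k → j m ≠ a ∧ b m a = 0)
    (hborno : ∃ t, k₀ ≤ t ∧ t < k ∧ j t = o ∧ ∀ m, t < m → m < k → j m ≠ o ∧ b m o = 0)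
    {φ : MvPolynomial (Fin 4) K} (hφ : f ∉ φ.vars) (h0φ : constantCoeff φ = 0)
    (hφa : coeff (Finsupp.single a 1) φ = -(ℓ k a / ℓ k f))
    (hφ3 : homogeneousComponent 3 (tsch f φ ((c k).F.divMonomial (c k).r)) = C (a0 k * ℓ k f ^ 3) * X f ^ 3)
    (hφN : ∀ n : Fin 4 →₀ ℕ, n f = 2 → n.degree ≤ 9 → coeff n (tsch f φ ((c k).F.divMonomial (c k).r)) = 0)
    {ψ : MvPolynomial (Fin 4) K} (hψ : a ∉ ψ.vars) (h0ψ : constantCoeff ψ = 0)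
    (hψ3 : homogeneousComponent 3 (tsch a ψ ((c (k + 1)).F.divMonomial (c (k + 1)).r)) =
      C (a0 (k + 1) * ℓ (k + 1) a ^ 3) * X a ^ 3)
    (hψN : ∀ n : Fin 4 →₀ ℕ, n a = 2 → n.degree ≤ 9 →
      coeff n (tsch a ψ ((c (k + 1)).F.divMonomial (c (k + 1)).r)) = 0) :
      (coeff ((c k).r + (Finsupp.single a 2 + Finsupp.single o 2)) (deletePthPowers 5 (tsch f φ (c k).F)) = 0 ∧
      coeff ((c k).r + (Finsupp.single a 3 + Finsupp.single o 1)) (deletePthPowers 5 (tsch f φ (c k).F)) = 0 ∧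
      coeff ((c k).r + (Finsupp.single a 2 + Finsupp.single o 1 + Finsupp.single ν 1))
        (deletePthPowers 5 (tsch f φ (c k).F)) = 0 ∧
      coeff ((c k).r + (Finsupp.single a 4 + Finsupp.single o 1)) (deletePthPowers 5 (tsch f φ (c k).F)) = 0 ∧
      coeff ((c k).r + (Finsupp.single f 1 + Finsupp.single a 2 + Finsupp.single o 1))
        (deletePthPowers 5 (tsch f φ (c k).F)) = 0) ∧
    (coeff ((c k).r + (Finsupp.single a 2 + Finsupp.single o 3)) (deletePthPowers 5 (tsch f φ (c k).F)) ≠ 0 →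
      coeff ((c (k + 1)).r + (Finsupp.single f 2 + Finsupp.single o 3)) (deletePthPowers 5 (tsch a ψ (c (k + 1)).F)) ≠ 0 ∨
      coeff ((c (k + 1)).r + (Finsupp.single f 1 + Finsupp.single o 3)) (deletePthPowers 5 (tsch a ψ (c (k + 1)).F)) ≠ 0 ∨
      coeff ((c (k + 1)).r + (Finsupp.single f 2 + Finsupp.single o 2)) (deletePthPowers 5 (tsch a ψ (c (k + 1)).F)) ≠ 0) ∧
    (coeff ((c k).r + (Finsupp.single a 1 + Finsupp.single o 3)) (deletePthPowers 5 (tsch f φ (c k).F)) ≠ 0 →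
      coeff ((c (k + 1)).r + (Finsupp.single f 1 + Finsupp.single o 3)) (deletePthPowers 5 (tsch a ψ (c (k + 1)).F)) ≠ 0) ∧
    (coeff ((c k).r + (Finsupp.single a 3 + Finsupp.single o 2)) (deletePthPowers 5 (tsch f φ (c k).F)) ≠ 0 →
      coeff ((c (k + 1)).r + (Finsupp.single f 2 + Finsupp.single o 2)) (deletePthPowers 5 (tsch a ψ (c (k + 1)).F)) ≠ 0) ∧
    (coeff ((c k).r + (Finsupp.single a 4 + Finsupp.single o 2)) (deletePthPowers 5 (tsch f φ (c k).F)) ≠ 0 →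
      coeff ((c (k + 1)).r + (Finsupp.single o 2 + Finsupp.single f 3)) (deletePthPowers 5 (tsch a ψ (c (k + 1)).F)) ≠ 0 ∨
      coeff ((c (k + 1)).r + (Finsupp.single o 1 + Finsupp.single f 3)) (deletePthPowers 5 (tsch a ψ (c (k + 1)).F)) ≠ 0 ∨
      coeff ((c (k + 1)).r + (Finsupp.single o 2 + Finsupp.single f 2)) (deletePthPowers 5 (tsch a ψ (c (k + 1)).F)) ≠ 0) ∧
    (coeff ((c k).r + (Finsupp.single f 1 + Finsupp.single a 1 + Finsupp.single o 2)) (deletePthPowers 5 (tsch f φ (c k).F)) ≠ 0 →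
      coeff ((c (k + 1)).r + (Finsupp.single a 1 + Finsupp.single f 1 + Finsupp.single o 2))
        (deletePthPowers 5 (tsch a ψ (c (k + 1)).F)) ≠ 0) ∧
    (coeff ((c (k + 1)).r + (Finsupp.single f 1 + Finsupp.single o 3)) (deletePthPowers 5 (tsch a ψ (c (k + 1)).F)) ≠ 0 ∨
      coeff ((c (k + 1)).r + (Finsupp.single f 2 + Finsupp.single o 2)) (deletePthPowers 5 (tsch a ψ (c (k + 1)).F)) ≠ 0 ∨
      coeff ((c (k + 1)).r + (Finsupp.single f 1 + Finsupp.single o 2 + Finsupp.single ν 1))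
        (deletePthPowers 5 (tsch a ψ (c (k + 1)).F)) ≠ 0 ∨
      coeff ((c (k + 1)).r + (Finsupp.single f 2 + Finsupp.single o 3)) (deletePthPowers 5 (tsch a ψ (c (k + 1)).F)) ≠ 0 ∨
      coeff ((c (k + 1)).r + (Finsupp.single f 2 + Finsupp.single o 4)) (deletePthPowers 5 (tsch a ψ (c (k + 1)).F)) ≠ 0 ∨
      coeff ((c (k + 1)).r + (Finsupp.single a 1 + Finsupp.single f 1 + Finsupp.single o 2))
        (deletePthPowers 5 (tsch a ψ (c (k + 1)).F)) ≠ 0 ∨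
      coeff ((c (k + 1)).r + (Finsupp.single a 1 + Finsupp.single f 2 + Finsupp.single o 1))
        (deletePthPowers 5 (tsch a ψ (c (k + 1)).F)) ≠ 0 ∨
      coeff ((c (k + 1)).r + (Finsupp.single f 1 + Finsupp.single o 4)) (deletePthPowers 5 (tsch a ψ (c (k + 1)).F)) ≠ 0) := by
  haveI : Fact (Nat.Prime 5) := ⟨by norm_num⟩
  have h3K : (3 : K) ≠ 0 := fun h =>
    absurd ((CharP.cast_eq_zero_iff K 5 3).mp (by exact_mod_cast h)) (by norm_num)
  have hfo : f ≠ o := hof.symm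
  have hfν : f ≠ ν := hνf.symm
  obtain ⟨ta, hta, htak, hja, hkepta⟩ := hborna
  obtain ⟨tₒ, htₒ, htₒk, hjo, hkepto⟩ := hborno
  have hdivk := IsolatedBand.isolated_chain_forall_le hc hr0
  -- the translation and its inverse
  set τ' : K := b k a with hτ'
  set τ : K := -(ℓ k a / ℓ k f) with hτ
  have hdirk : ℓ k f + ℓ k a * τ' = 0 := by
    have h := hdir k hk
    rw [hjk, hb, dotProduct_single] at h
    exact h
  have hℓa : ℓ k a ≠ 0 := by
    intro h0
    rw [h0, zero_mul, add_zero] at hdirk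
    exact hℓf hdirk
  have hττ' : τ * τ' = 1 := by
    have h1 : ℓ k a * τ' = -ℓ k f := by linear_combination hdirk
    calc τ * τ' = -(ℓ k a * τ') / ℓ k f := by rw [hτ]; ring
      _ = 1 := by rw [h1, neg_neg, div_self hℓf]
  have hτ'0 : τ' ≠ 0 := fun h0 => by rw [h0, mul_zero] at hττ'; exact zero_ne_one hττ'
  -- the real child and the partner
  have hck : c (k + 1) = CentreBlowup.step 5 Finset.univ f (Pi.single a τ') (c k) := by
    rw [(hw k).2.2.2.2, hjk, ← hb]
  set B := CentreBlowup.step 5 Finset.univ a (Pi.single f τ) (c k) with hB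
  have hF5 : ((5 : ℕ) : ℕ∞) ≤ ordAlong Finset.univ (c k).F := by
    rw [ordAlong_univ, hord k hk]; exact_mod_cast (by norm_num)
  have ha0 : ∀ k', k₀ ≤ k' → a0 k' ≠ 0 := fun k' hk' =>
    ne_zero_of_resForm_eq_C_mul (hord k' hk') (hdivk k') (hform k' hk')
  have hℓa' : ℓ (k + 1) a ≠ 0 := by
    rw [hprop k hk a (by rw [hjk]; exact haf)]; exact mul_ne_zero (hlam k hk) hℓa
  have hℓ1 : ℓ (k + 1) ≠ 0 := fun h0 => hℓa' (by rw [h0]; rfl)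
  -- the partner's order, isolation, `e_G` and cone (SN1 + the diagonal relation)
  obtain ⟨N, hN⟩ := RidgeBudget.exists_isCert_of_isIsolated (hc (k + 1)).1
  have hiso1 := (hc (k + 1)).1
  have hord1 := hord (k + 1) (by omega)
  have hdiv1 := hdivk (k + 1)
  have hform1 := hform (k + 1) (by omega)
  rw [hck] at hN hiso1 hord1 hdiv1 hform1
  obtain ⟨hoB, hisoB, he3B, α', ℓ', hα', hℓ'f, -, -, hformB⟩ := rotation_partner_readings 5 hF5 haf hττ' hiso1 hN
    hord1 (by norm_num) hdiv1 hform1 (ha0 (k + 1) (by omega)) hℓ1 (by norm_num) (by norm_num)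
  have hℓ'f0 : ℓ' f ≠ 0 := by
    rw [hℓ'f]; exact mul_ne_zero (neg_ne_zero.mpr (mul_ne_zero hτ'0 hτ'0)) hℓa'
  -- the partner's boundary and divisibility
  obtain ⟨-, -, -, -, -, -, -, -, hrB⟩ := rotation_partner_rel 5 hF5 haf hττ' (M := 1) le_rfl
  have hrB' : B.r = (c k).r := by
    rw [hB, hrB, ← hck, hrk', mapDomain_swap_boundary hao haν hfo hfν, hrk]
  have hdivB : ∀ e ∈ B.F.support, B.r ≤ e := by
    refine newMult_le_of_mem_support_step 5 Finset.univ a (Pi.single f τ : Fin 4 → K)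
      (by rw [Pi.single_eq_of_ne haf]) (c k) (hord k hk) (hdivk k) fun d hd => ?_
    rw [degIn_univ, degIn_univ]
    have hod : 6 ≤ d.degree := by
      have := Literature.Barriers.ResolutionOfSingularities.ordZero_le_of_coeff_ne_zero _ _
        (MvPolynomial.mem_support_iff.mp hd)
      rw [hord k hk] at this
      exact_mod_cast this
    have hrd : (c k).r.degree ≤ d.degree := PointBlowup.degree_le_degree_of_le (hdivk k d hd)
    omega
  have hrBdeg : B.r.degree = 3 := by rw [hrB', hrk, map_add, map_add]; simp
  -- the partner's canonical frame (β1)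
  obtain ⟨ψB, h0ψB, hψBv, -, hψB3, hψBN⟩ := FrameChange.exists_canonical_frame_state f (d := 3) (by norm_num) h3K
    hoB hdivB (by rw [hrBdeg]) hα' hℓ'f0 hformB 7
  -- the ledger at `k` (β3): `x_a`-free readings vanish
  have hrf : (c k).r f = 0 := by rw [hrk]; simp [haf, hof, hνf]
  have hdivκ : ∀ m : Fin 4 →₀ ℕ, m a = 0 → m f ≤ 1 → m.degree ≤ 5 →
      coeff ((c k).r + m) (deletePthPowers 5 (tsch f φ (c k).F)) = 0 := fun m hma hmf hm =>
    frame_reading_eq_zero_of_born 5 hc hw hr0 hfloor (by norm_num) hshade hform hdir hlam hprop hcarry hao haf hof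
      hℓf hrf hta htak hja hkepta htₒ htₒk hjo hkepto hφ h0φ (N := 7) (fun n hnf hn => hφN n hnf (by omega))
      (by omega) (by omega) (Or.inl hma)
  -- β4-S on the partner (a slot step of `c k` charting `a`)
  have ha : a0 k * ℓ k f ^ 3 ≠ 0 := mul_ne_zero (ha0 k hk) (pow_ne_zero _ hℓf)
  have hψBN' : ∀ n : Fin 4 →₀ ℕ, n f = 2 → n.degree ≤ 7 + 2 →
      coeff n (tsch f ψB (B.F.divMonomial B.r)) = 0 := fun n hnf hn => hψBN n (by rw [hnf]) (by omega)
  have hφN' : ∀ n : Fin 4 →₀ ℕ, n f = 2 → n.degree ≤ 7 + 2 → coeff n (tsch f φ ((c k).F.divMonomial (c k).r)) = 0 :=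
    fun n hnf hn => hφN n hnf (by omega)
  obtain ⟨-, hleg, hflagB, hrel1, hrel2, hrel3⟩ := slot_step_readings hao haν haf hoν hof hνf (s := c k) hrk (hdivk k)
    (hord k hk) hclean hdivB hoB he3B hisoB hφ h0φ hφa ha hφ3 (le_refl 7) hφN' hdivκ hψBv h0ψB hψB3 hψBN'
  have hrel4 := slot_step_relabel_one_three hao haν haf hoν hof hνf (s := c k) hrk (hdivk k) (hord k hk) hclean hdivB
    hoB he3B hφ h0φ hφa ha hφ3 (le_refl 7) hφN' hψBv h0ψB hψB3 hψBN'
  have hrel5 := slot_step_relabel_f_one_two hao haν haf hoν hof hνf (s := c k) hrk (hdivk k) (hord k hk) hclean hdivB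
    hoB he3B hφ h0φ hφa ha hφ3 (le_refl 7) hφN' hψBv h0ψB hψB3 hψBN'
  -- the framed swap relation `S̃_B ← S̃_{c(k+1)}` and its order `s = 3`
  obtain ⟨Θ, e, G, U, E, hΘi, hΘf, he, hG0, hG1, hU, hE, hrel⟩ := rotation_frame_rel 5 hF5 haf hττ' (M := 10)
    (by norm_num) hψ h0ψ hψBv h0ψB
  rw [← hck] at hrel
  set P := deletePthPowers 5 (tsch a ψ (c (k + 1)).F) with hP
  set Q := deletePthPowers 5 (tsch f ψB B.F) with hQ
  -- the real child's framed structure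
  have hr'a : (c (k + 1)).r a = 0 := by rw [hrk']; simp [haf.symm, hao, haν]
  have hr'deg : (c (k + 1)).r.degree = 3 := by rw [hrk', map_add, map_add]; simp
  set G' := (c (k + 1)).F.divMonomial (c (k + 1)).r with hG'
  have hF'G' : (c (k + 1)).F = monomial (c (k + 1)).r 1 * G' := (monomial_mul_divMonomial (hdivk (k + 1))).symm
  have hclean1 : deletePthPowers 5 (c (k + 1)).F = (c (k + 1)).F := by
    rw [(hw k).2.2.2.2]; exact deletePthPowers_step_F 5 Finset.univ (j k) (b k) (c k)
  have hoP : ordZero P = ((6 : ℕ) : ℕ∞) := by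
    rw [hP, ordZero_clean_tsch (p := 5) hψ h0ψ hclean1, hord (k + 1) (by omega)]
  have hdivP : ∀ m ∈ P.support, (c (k + 1)).r ≤ m := forall_le_of_mem_support_clean_tsch 5 hr'a (hdivk (k + 1))
  have hreadP : ∀ m : Fin 4 →₀ ℕ, m ν ≤ 3 → coeff ((c (k + 1)).r + m) P = coeff m (tsch a ψ G') := fun m hmν =>
    coeff_clean_tsch_boundary_add 5 ψ hr'a hF'G' (not_isPthPowerExponent_boundary_add hfν hoν hrk' hmν)
  have hG'3 : ∀ m : Fin 4 →₀ ℕ, m.degree = 3 → m ≠ Finsupp.single a 3 → coeff m (tsch a ψ G') = 0 := by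
    intro m hm hne
    rw [← coeff_homogeneousComponent 3 (tsch a ψ G') m |>.trans (if_pos hm), hψ3, X_pow_eq_monomial, C_mul_monomial,
      mul_one, coeff_monomial, if_neg (Ne.symm hne)]
  have hZ2 : ∀ m : Fin 4 →₀ ℕ, m.degree ≤ 2 → coeff ((c (k + 1)).r + m) P = 0 := fun m hm =>
    coeff_eq_zero_of_degree_lt_ordZero (by rw [hoP, map_add, hr'deg]; exact_mod_cast (by omega))
  have hZ3 : ∀ m : Fin 4 →₀ ℕ, m.degree = 3 → m a ≤ 2 → coeff ((c (k + 1)).r + m) P = 0 := by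
    intro m hm hma
    have hmν : m ν ≤ 3 := by have := Finsupp.le_degree ν m; omega
    rw [hreadP m hmν]
    exact hG'3 m hm fun h => by rw [h, Finsupp.single_eq_same] at hma; omega
  have hA : ∀ m ∈ P.support, (c (k + 1)).r.degree + 3 ≤ m.degree := by
    intro m hm
    by_contra hlt
    exact (mem_support_iff.mp hm) (coeff_eq_zero_of_degree_lt_ordZero (by rw [hoP]; exact_mod_cast (by omega)))
  have hAcone : ∀ m ∈ P.support, m.degree = (c (k + 1)).r.degree + 3 → m = (c (k + 1)).r + Finsupp.single a 3 := by
    intro m hm hdeg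
    obtain ⟨m₁, rfl⟩ : ∃ m₁, m = (c (k + 1)).r + m₁ := ⟨m - (c (k + 1)).r, (add_tsub_cancel_of_le (hdivP m hm)).symm⟩
    rw [map_add] at hdeg
    have hm₁ : m₁.degree = 3 := by omega
    by_contra hne
    have hne' : m₁ ≠ Finsupp.single a 3 := fun h => hne (by rw [h])
    have hmν : m₁ ν ≤ 3 := by have := Finsupp.le_degree ν m₁; omega
    exact (mem_support_iff.mp hm) (by rw [hreadP m₁ hmν]; exact hG'3 m₁ hm₁ hne')
  have haP : coeff ((c (k + 1)).r + Finsupp.single a 3) P ≠ 0 := by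
    rw [hreadP _ (by simp [haν]), ← coeff_homogeneousComponent 3 (tsch a ψ G') _ |>.trans
      (if_pos (Finsupp.degree_single a 3)), hψ3, X_pow_eq_monomial, C_mul_monomial, mul_one, coeff_monomial, if_pos rfl]
    exact mul_ne_zero (ha0 (k + 1) (by omega)) (pow_ne_zero _ hℓa')
  have hA4 : ∀ i k', i ≠ a → k' ≠ a →
      coeff ((c (k + 1)).r + Finsupp.single a 2 + Finsupp.single i 1 + Finsupp.single k' 1) P = 0 := by
    intro i k' hia hk'a
    rw [add_assoc, add_assoc, hreadP _ (by
      simp only [Finsupp.add_apply, Finsupp.single_apply, haν, if_false, zero_add]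
      split_ifs <;> omega)]
    refine hψN _ (by simp [Ne.symm hia, Ne.symm hk'a]) ?_
    rw [map_add, map_add, Finsupp.degree_single, Finsupp.degree_single, Finsupp.degree_single]; omega
  -- the partner's framed structure
  set GB := B.F.divMonomial B.r with hGB
  have hFBGB : B.F = monomial B.r 1 * GB := (monomial_mul_divMonomial hdivB).symm
  have hrBf : B.r f = 0 := by rw [hrB', hrf]
  have hreadQ : ∀ m : Fin 4 →₀ ℕ, m ν ≤ 3 → coeff ((c k).r + m) Q = coeff m (tsch f ψB GB) := fun m hmν => by
    rw [hQ, ← hrB']; exact coeff_clean_tsch_boundary_add 5 ψB hrBf hFBGB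
      (by rw [hrB']; exact not_isPthPowerExponent_boundary_add haν hoν hrk hmν)
  have hGB3 : ∀ m : Fin 4 →₀ ℕ, m.degree = 3 → m ≠ Finsupp.single f 3 → coeff m (tsch f ψB GB) = 0 := by
    intro m hm hne
    rw [← coeff_homogeneousComponent 3 (tsch f ψB GB) m |>.trans (if_pos hm), hψB3, X_pow_eq_monomial, C_mul_monomial,
      mul_one, coeff_monomial, if_neg (Ne.symm hne)]
  have hrBswap : (c (k + 1)).r.mapDomain (Equiv.swap a f).symm = (c k).r := by
    rw [hrk', mapDomain_swap_boundary hao haν hfo hfν, hrk]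
  have hBst : ∀ i, i ≠ f →
      coeff ((c (k + 1)).r.mapDomain (Equiv.swap a f).symm + Finsupp.single f 2 + Finsupp.single i 1) Q = 0 := by
    intro i hif
    rw [hrBswap, add_assoc, hreadQ _ (by
      simp only [Finsupp.add_apply, Finsupp.single_apply, hfν, if_false, zero_add]; split_ifs <;> omega)]
    refine hGB3 _ (by rw [map_add, Finsupp.degree_single, Finsupp.degree_single]) fun h => ?_
    have := DFunLike.congr_fun h i
    simp [hif] at this
  have hB4 : ∀ i k', i ≠ f → k' ≠ f → coeff ((c (k + 1)).r.mapDomain (Equiv.swap a f).symm + Finsupp.single f 2 +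
      Finsupp.single i 1 + Finsupp.single k' 1) Q = 0 := by
    intro i k' hif hk'f
    rw [hrBswap, add_assoc, add_assoc, hreadQ _ (by
      simp only [Finsupp.add_apply, Finsupp.single_apply, hfν, if_false, zero_add]
      split_ifs <;> omega)]
    refine hψBN _ (by simp [Ne.symm hif, Ne.symm hk'f]) ?_
    rw [map_add, map_add, Finsupp.degree_single, Finsupp.degree_single, Finsupp.degree_single]; omega
  have hG3 := three_le_degree_of_framed_rel haf hao haν hfν hoν hrk' hΘi hΘf he hG0 hG1 hU hE hrel (by norm_num) hA
    hAcone haP hA4 hBst hB4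
  -- the born ledger at `k + 1` (letters `f` just born, `o` born before)
  have hkeptf : ∀ m, k < m → m < k + 1 → j m ≠ f ∧ b m f = 0 := fun m h1 h2 => by omega
  have hkepto' : ∀ m, tₒ < m → m < k + 1 → j m ≠ o ∧ b m o = 0 := by
    intro m h1 h2
    rcases Nat.lt_or_ge m k with h | h
    · exact hkepto m h1 h
    · have hm : m = k := by omega
      subst hm
      exact ⟨by rw [hjk]; exact hfo, by rw [hb, Pi.single_eq_of_ne hao.symm]⟩
  have hψN' : ∀ n : Fin 4 →₀ ℕ, n a = 2 → n.degree ≤ 7 + 2 →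
      coeff n (tsch a ψ ((c (k + 1)).F.divMonomial (c (k + 1)).r)) = 0 := fun n hna hn => hψN n hna (by omega)
  have hledger1 : ∀ m : Fin 4 →₀ ℕ, m.degree ≤ 7 → m a < 3 → m f = 0 ∨ m o = 0 →
      coeff ((c (k + 1)).r + m) P = 0 := fun m hm hma hmfo =>
    frame_reading_eq_zero_of_born 5 hc hw hr0 hfloor (by norm_num) hshade hform hdir hlam hprop hcarry (k := k + 1)
      hfo (Ne.symm haf) hao.symm hℓa' hr'a hk (Nat.lt_succ_self k) hjk hkeptf htₒ (by omega) hjo hkepto' hψ h0ψ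
      (N := 7) hψN' hm hma hmfo
  have hZ04 : coeff ((c (k + 1)).r + Finsupp.single o 4) P = 0 :=
    hledger1 _ (by rw [Finsupp.degree_single]; omega) (by simp [hao.symm]) (Or.inl (by simp [hfo.symm]))
  have hZa3 : coeff ((c (k + 1)).r + (Finsupp.single o 3 + Finsupp.single a 1)) P = 0 :=
    hledger1 _ (by rw [map_add, Finsupp.degree_single, Finsupp.degree_single]; omega) (by simp [hao])
      (Or.inl (by simp [hfo.symm, haf]))
  -- moving a partner reading to the real child's frame
  have hmove : ∀ n₀ : Fin 4 →₀ ℕ, coeff ((c k).r + n₀.mapDomain (Equiv.swap a f).symm) Q ≠ 0 →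
      coeff (((c (k + 1)).r + n₀).mapDomain (Equiv.swap a f).symm) Q ≠ 0 := fun n₀ h => by
    rwa [Finsupp.mapDomain_add, hrBswap]
  have T4 : ∀ n₀ : Fin 4 →₀ ℕ, n₀.degree = 4 → n₀ a ≤ 1 → n₀ ν ≤ 1 →
      coeff ((c k).r + n₀.mapDomain (Equiv.swap a f).symm) Q ≠ 0 → coeff ((c (k + 1)).r + n₀) P ≠ 0 :=
    fun n₀ hn hna hnν h => transfer_deg_four haf hao haν hfν hoν hrk' hΘi hΘf hG1 hG3 hE hrel hdivP hZ2 hZ3 hn hna hnν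
      (by norm_num) (hmove n₀ h)
  have T5 : ∀ {x y : Fin 4}, x ≠ y → x ≠ a → y ≠ a → x ≠ ν → y ≠ ν →
      coeff ((c k).r + (Finsupp.single x 2 + Finsupp.single y 3 : Fin 4 →₀ ℕ).mapDomain (Equiv.swap a f).symm) Q ≠ 0 →
      coeff ((c (k + 1)).r + (Finsupp.single x 2 + Finsupp.single y 3)) P ≠ 0 ∨
        coeff ((c (k + 1)).r + (Finsupp.single x 1 + Finsupp.single y 3)) P ≠ 0 ∨
        coeff ((c (k + 1)).r + (Finsupp.single x 2 + Finsupp.single y 2)) P ≠ 0 := by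
    intro x y hxy hxa hya hxν hyν h
    by_cases h22 : coeff ((c (k + 1)).r + (Finsupp.single x 2 + Finsupp.single y 2)) P = 0
    · rcases transfer_two_three haf hao haν hfν hoν hxy hxa hya hxν hyν hrk' hΘi hΘf hG1 hG3 hE hrel hdivP hZ2 hZ3
        (by norm_num) h22 (hmove _ h) with h' | h'
      · exact Or.inl h'
      · exact Or.inr (Or.inl h')
    · exact Or.inr (Or.inr h22)
  -- the swapped exponents
  have hsw_fo : ∀ x y : ℕ, (Finsupp.single f x + Finsupp.single o y : Fin 4 →₀ ℕ).mapDomain (Equiv.swap a f).symm =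
      Finsupp.single a x + Finsupp.single o y := mapDomain_swap_fo hao hfo
  have hsw_of : ∀ x y : ℕ, (Finsupp.single o x + Finsupp.single f y : Fin 4 →₀ ℕ).mapDomain (Equiv.swap a f).symm =
      Finsupp.single o x + Finsupp.single a y := mapDomain_swap_of hao hfo
  have hsw_foν : (Finsupp.single f 1 + Finsupp.single o 2 + Finsupp.single ν 1 : Fin 4 →₀ ℕ).mapDomain
      (Equiv.swap a f).symm = Finsupp.single a 1 + Finsupp.single o 2 + Finsupp.single ν 1 := by
    rw [Finsupp.mapDomain_add, hsw_fo, mapDomain_swap_single_of_ne haν.symm hfν.symm]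
  have hsw_afo : (Finsupp.single a 1 + Finsupp.single f 1 + Finsupp.single o 2 : Fin 4 →₀ ℕ).mapDomain
      (Equiv.swap a f).symm = Finsupp.single f 1 + Finsupp.single a 1 + Finsupp.single o 2 := by
    rw [Finsupp.mapDomain_add, Finsupp.mapDomain_add, mapDomain_swap_single_left,
      mapDomain_swap_single_of_ne hao.symm hfo.symm, Finsupp.mapDomain_single, Equiv.symm_swap,
      Equiv.swap_apply_right]
  refine ⟨hleg, fun h => ?_, fun h => ?_, fun h => ?_, fun h => ?_, fun h => ?_, ?_⟩
  · -- (2)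
    exact T5 hfo (Ne.symm haf) hao.symm hfν hoν (by rw [hsw_fo, hrel1]; exact h)
  · -- (3)
    exact T4 _ (by rw [map_add, Finsupp.degree_single, Finsupp.degree_single]) (by simp [haf, hao])
      (by simp [hfν.symm, hoν.symm]) (by rw [hsw_fo, hrel4]; exact h)
  · -- (4)
    exact T4 _ (by rw [map_add, Finsupp.degree_single, Finsupp.degree_single]) (by simp [haf, hao])
      (by simp [hfν.symm, hoν.symm]) (by rw [hsw_fo, hrel2]; exact h)
  · -- (5)
    refine T5 hof hao.symm (Ne.symm haf) hoν hfν ?_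
    rw [hsw_of, add_comm (Finsupp.single o 2) (Finsupp.single a 3), hrel3]; exact h
  · -- (6)
    exact T4 _ (by rw [map_add, map_add, Finsupp.degree_single, Finsupp.degree_single, Finsupp.degree_single])
      (by simp [haf, hao]) (by simp [haν.symm, hfν.symm, hoν.symm]) (by rw [hsw_afo, hrel5]; exact h)
  · -- (7) the flag
    rcases hflagB with h | h | h | h | h | h
    · exact Or.inl (T4 _ (by rw [map_add, Finsupp.degree_single, Finsupp.degree_single]) (by simp [haf, hao])
        (by simp [hfν.symm, hoν.symm]) (by rw [hsw_fo]; exact h))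
    · exact Or.inr (Or.inl (T4 _ (by rw [map_add, Finsupp.degree_single, Finsupp.degree_single]) (by simp [haf, hao])
        (by simp [hfν.symm, hoν.symm]) (by rw [hsw_fo]; exact h)))
    · exact Or.inr (Or.inr (Or.inl (T4 _
        (by rw [map_add, map_add, Finsupp.degree_single, Finsupp.degree_single, Finsupp.degree_single])
        (by simp [haf, hao, haν]) (by simp [hfν.symm, hoν.symm]) (by rw [hsw_foν]; exact h))))
    · rcases T5 hfo (Ne.symm haf) hao.symm hfν hoν (by rw [hsw_fo]; exact h) with h' | h' | h'
      · exact Or.inr (Or.inr (Or.inr (Or.inl h')))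
      · exact Or.inl h'
      · exact Or.inr (Or.inl h')
    · by_cases h22 : coeff ((c (k + 1)).r + (Finsupp.single f 2 + Finsupp.single o 2)) P = 0
      · rcases transfer_two_four haf hao haν hfν hoν hfo (Ne.symm haf) hao.symm hfν hoν hrk' hΘi hΘf hG1 hG3 hE hrel
          hdivP hZ2 hZ3 (by norm_num) h22 hZ04 hZa3 (hmove _ (by rw [hsw_fo]; exact h)) with
          h' | h' | h' | h' | h' | h'
        · exact Or.inr (Or.inr (Or.inr (Or.inr (Or.inl h'))))
        · exact Or.inl h'
        · exact Or.inr (Or.inr (Or.inr (Or.inr (Or.inr (Or.inr (Or.inr h'))))))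
        · exact Or.inr (Or.inr (Or.inr (Or.inl h')))
        · refine Or.inr (Or.inr (Or.inr (Or.inr (Or.inr (Or.inl ?_)))))
          rw [add_comm (Finsupp.single a 1) (Finsupp.single f 1), add_right_comm (Finsupp.single f 1) (Finsupp.single a 1)]
          exact h'
        · refine Or.inr (Or.inr (Or.inr (Or.inr (Or.inr (Or.inr (Or.inl ?_))))))
          rw [add_comm (Finsupp.single a 1) (Finsupp.single f 2), add_right_comm (Finsupp.single f 2) (Finsupp.single a 1)]
          exact h'
      · exact Or.inr (Or.inl h22)
    · refine Or.inr (Or.inr (Or.inr (Or.inr (Or.inr (Or.inl (T4 _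
        (by rw [map_add, map_add, Finsupp.degree_single, Finsupp.degree_single, Finsupp.degree_single])
        (by simp [haf, hao]) (by simp [haν.symm, hfν.symm, hoν.symm]) (by rw [hsw_afo]; exact h)))))))

end Rotation

end ResCone

end Summit.ResolutionOfSingularities.ResolutionOfSingularities.Theorems.PIDim4

end
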